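import Literature.Analysis.FluidPDE.PeriodicBoundedMildMean
import Literature.Analysis.FluidPDE.KochTataruKernelFourier
import Literature.Analysis.FunctionSpaces.TorusHeatSmoothing
import Literature.Analysis.FunctionSpaces.TorusFourierCalculus
import Literature.Analysis.FunctionSpaces.TorusPeriodization
import Literature.Analysis.FunctionSpaces.TorusKernelApproximation
import HarnessLib

/-!
# Fourier coefficients of the Oseen slice and of the heat flow of periodic data

Analysis/FluidPDE support file (everything proved; no definitions, no named facts) on the proof
path of the corrected perturbation theorem of M. P. Coiculescu, S. Palasek, Invent. Math. 244
(2025), arXiv:2503.14699, Props. 4.2–4.3 (hypothesis `hB`, `κ ≤ α`, of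
`Literature.Barriers.NavierStokesRegularity.CoiculescuPalasek2025_construction_of_parts'`).

The tree realises `e^{σΔ}P∇·` on the whole space by the Oseen–Koch–Tataru kernel
(`oseenSlice σ a b (y) = ∫ K(σ, z)[a(y - z), b(y - z)] dz`) and computes its Fourier symbol
(`fourier_inner_oseenKernel_eq_leraySymbol`: `K̂(σ,ξ)[a,b] = 2πi⟪ξ,a⟫ Ĝ_σ(ξ) P(ξ)b`). On the flat
torus `𝕋ᵈ = ℝᵈ/ℤᵈ` both the paper's heat/Leray calculus (§2.2, §2.3: Fourier multipliers on
`𝕋³`) and the tree's kernels are available once **periodisation** is recorded: for continuous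
`b₁, b₂ : 𝕋ᵈ → ℝᵈ` with lifts `b̃ᵢ = bᵢ ∘ proj`,

* `Torus.mFourierCoeff_inner_oseenSlice_lift` — the `k`-th Fourier coefficient of
  `x ↦ ⟪N_σ[b̃₁, b̃₂](repr x), w⟫` is `∑_{j,l} K̂(σ, k)[eⱼ, eₗ]·w · (b₁ⱼ b₂ₗ)^(k)` (Fubini over
  `𝕋ᵈ × ℝᵈ`, translation invariance of Haar measure, multiplicativity of the characters,
  bilinearity of `K`) — the torus form of "`e^{σΔ}P∇·` is the Fourier multiplier
  `2πi e^{-4π²σ|k|²} P(k)(k·)`";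
* `Torus.norm_mFourierCoeff_inner_oseenSlice_lift_le` — hence
  `|(⟪N_σ[b̃₁,b̃₂], w⟫)^(k)| ≤ 2π |k| ‖w‖ ∑_{j,l} |(b₁ⱼb₂ₗ)^(k)|` (`|Ĝ_σ| ≤ 1`, `‖P(ξ)‖ ≤ 1`), the
  `Ḣ^{-1}`-type control of the Oseen slice behind "`w(t) → 0` in `𝒞^{-1+α/2}`" (Prop. 4.3);
* `Torus.mFourierCoeff_inner_heatExtension_lift` — `(⟪e^{tΔ}ã, w⟫)^(k) = e^{-4π²t|k|²}(⟪a,w⟫)^(k)`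
  (the tree's `Torus.integral_heatKernel_mul_mFourier`).

## References

* M. P. Coiculescu, S. Palasek, Invent. Math. 244 (2025) = arXiv:2503.14699, §2.2 (Fourier
  multipliers on `𝕋³`), §2.3, proof of Prop. 4.3. [CoiculescuPalasek2025]
* H. Koch, D. Tataru, Adv. Math. 157 (2001), §2 (5)–(8) (the symbol). [KochTataruAdvMath2001]
* L. Grafakos, *Classical Fourier Analysis*, 3rd ed., §3.1.1 (Fourier coefficients on `𝕋ⁿ`,
  Poisson summation viewpoint). [Grafakos2014]
-/

noncomputable section

open MeasureTheory Set Function Filter TopologicalSpace InnerProductSpace Metric UnitAddTorus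
open Literature.Analysis.FunctionSpaces Literature.Analysis.FunctionSpaces.Torus
open _root_.Topology
open scoped RealInnerProductSpace NNReal ENNReal FourierTransform

namespace Literature.Analysis.FluidPDE

namespace Torus

variable {d : Type*} [Fintype d] [DecidableEq d]

/-! ### Characters -/

omit [DecidableEq d] in
/-- `|e_n(x)| ≤ 1`. [folklore] -/
theorem norm_mFourier_apply_le_one (n : d → ℤ) (x : UnitAddTorus d) : ‖mFourier n x‖ ≤ 1 := by
  have h := (mFourier n).norm_coe_le_norm x
  rwa [UnitAddTorus.mFourier_norm] at h

/-- **Multiplicativity of the lifted characters**: `e_n(x + proj z) = e_n(x) e_n(proj z)`.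
[folklore] -/
theorem mFourier_add_proj (n : d → ℤ) (x : UnitAddTorus d) (z : EuclideanSpace ℝ d) :
    mFourier n (x + proj z) = mFourier n x * mFourier n (proj z) := by
  conv_lhs => rw [← proj_repr x, ← proj_add]
  conv_rhs => rw [← proj_repr x]
  rw [mFourier_proj_eq_fourierChar, mFourier_proj_eq_fourierChar, mFourier_proj_eq_fourierChar,
    inner_add_left, AddChar.map_add_eq_mul]
  push_cast
  ring

/-! ### Bilinear expansion of the kernel in coordinates -/

omit [DecidableEq d] in
/-- `⟪K(τ,z)[u, v], w⟫ = ∑ⱼ ∑ₗ uⱼ vₗ ⟪K(τ,z)[eⱼ, eₗ], w⟫`. [folklore] -/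
theorem inner_oseenKernel_eq_sum_coord [DecidableEq d] (τ : ℝ) (z u v w : EuclideanSpace ℝ d) :
    ⟪oseenKernel τ z u v, w⟫ = ∑ j, ∑ l, u j * v l *
      ⟪oseenKernel τ z (EuclideanSpace.single j 1) (EuclideanSpace.single l 1), w⟫ := by
  have hu : u = ∑ j, u j • EuclideanSpace.single j (1 : ℝ) := by
    simpa [EuclideanSpace.basisFun_apply] using ((EuclideanSpace.basisFun d ℝ).sum_repr u).symm
  have hv : v = ∑ l, v l • EuclideanSpace.single l (1 : ℝ) := by
    simpa [EuclideanSpace.basisFun_apply] using ((EuclideanSpace.basisFun d ℝ).sum_repr v).symm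
  conv_lhs => rw [hu, hv]
  rw [show oseenKernel τ z (∑ j, u j • EuclideanSpace.single j (1 : ℝ))
      (∑ l, v l • EuclideanSpace.single l (1 : ℝ)) =
      (oseenKernelCLM τ z) (∑ j, u j • EuclideanSpace.single j (1 : ℝ))
        (∑ l, v l • EuclideanSpace.single l (1 : ℝ)) from (oseenKernelCLM_apply _ _ _ _).symm]
  simp only [map_sum, map_smul, sum_apply, IsSMulApply.smul_apply, oseenKernelCLM_apply,
    sum_inner, inner_smul_left, Finset.mul_sum]
  rw [Finset.sum_comm]
  refine Finset.sum_congr rfl fun j _ => Finset.sum_congr rfl fun l _ => ?_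
  simp only [RCLike.conj_to_real]
  ring

/-! ### Periodisation of the Oseen slice -/

/-- **Fourier coefficients of the Oseen slice of periodic data (periodisation).** For continuous
`b₁, b₂ : 𝕋ᵈ → ℝᵈ`, `τ > 0`, `w ∈ ℝᵈ` and `k ∈ ℤᵈ`, the `k`-th Fourier coefficient of
`x ↦ ⟪N_τ[b̃₁, b̃₂](repr x), w⟫` (`N_τ = oseenSlice τ`, `b̃ᵢ = lift bᵢ`) equals
`∑ⱼ ∑ₗ 𝓕(z ↦ ⟪K(τ,z)[eⱼ,eₗ], w⟫)(k) · (b₁ⱼ b₂ₗ)^(k)`: on periodic data `e^{τΔ}P∇·` acts as the Fourier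
multiplier given by the symbol of its kernel at the lattice points (Fubini over `𝕋ᵈ × ℝᵈ` under
the envelope `‖K(τ,z)‖ ≲ (τ + |z|²)^{-(d+1)/2}`, translation invariance of Haar measure on `𝕋ᵈ`,
`e_{-k}(x + proj z) = e_{-k}(x)e_{-k}(proj z)`, `e_{-k}(proj z) = 𝐞(-⟪z,k⟫)`, and the coordinate
expansion of the bilinear kernel). [cite: CoiculescuPalasek2025, §2.2 (Fourier multipliers on 𝕋³; e^{tΔ}P∇· as a multiplier)] -/
theorem mFourierCoeff_inner_oseenSlice_lift {b₁ b₂ : UnitAddTorus d → EuclideanSpace ℝ d}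
    (hb₁ : Continuous b₁) (hb₂ : Continuous b₂) {τ : ℝ} (hτ : 0 < τ) (w : EuclideanSpace ℝ d)
    (k : d → ℤ) :
    mFourierCoeff (fun x : UnitAddTorus d =>
      ((⟪oseenSlice τ (Torus.lift b₁) (Torus.lift b₂) (Torus.repr x), w⟫ : ℝ) : ℂ)) k =
      ∑ j, ∑ l, 𝓕 (fun z : EuclideanSpace ℝ d =>
          ((⟪oseenKernel τ z (EuclideanSpace.single j 1) (EuclideanSpace.single l 1), w⟫ : ℝ) : ℂ))
          (latticeVec k) *
        mFourierCoeff (fun x : UnitAddTorus d => ((b₁ x j * b₂ x l : ℝ) : ℂ)) k := by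
  obtain ⟨C₁, hC₁0, hC₁⟩ := TorusHeat.exists_norm_le hb₁
  obtain ⟨C₂, hC₂0, hC₂⟩ := TorusHeat.exists_norm_le hb₂
  obtain ⟨C, hC, hK⟩ := exists_norm_oseenKernel_le (E := EuclideanSpace ℝ d)
  -- the pieces
  set Kjl : d → d → EuclideanSpace ℝ d → ℂ := fun j l z =>
    ((⟪oseenKernel τ z (EuclideanSpace.single j 1) (EuclideanSpace.single l 1), w⟫ : ℝ) : ℂ) with hKjl
  set g : EuclideanSpace ℝ d → UnitAddTorus d → ℂ := fun z y =>
    ((⟪oseenKernel τ z (b₁ y) (b₂ y), w⟫ : ℝ) : ℂ) with hg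
  -- ### Step 1: the slice at `repr x` as an integral over `z`, in `ℂ`
  have h1 : ∀ x : UnitAddTorus d,
      ((⟪oseenSlice τ (Torus.lift b₁) (Torus.lift b₂) (Torus.repr x), w⟫ : ℝ) : ℂ) =
        ∫ z, g z (x - Torus.proj z) := by
    intro x
    have hl₁ : Measurable (Torus.lift b₁) := (hb₁.comp Torus.continuous_proj).measurable
    have hl₂ : Measurable (Torus.lift b₂) := (hb₂.comp Torus.continuous_proj).measurable
    have hint : Integrable (fun z => oseenKernel τ z (Torus.lift b₁ (Torus.repr x - z))
        (Torus.lift b₂ (Torus.repr x - z))) volume :=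
      integrable_oseenKernel_slice_sub hτ hl₁ hl₂
        (fun y => by rw [Torus.lift_apply]; exact hC₁ _) (fun y => by rw [Torus.lift_apply]; exact hC₂ _)
        (Torus.repr x)
    rw [oseenSlice_eq_integral_sub, real_inner_comm, ← integral_inner hint, ← integral_complex_ofReal]
    refine integral_congr_ae (Eventually.of_forall fun z => ?_)
    simp only [hg, lift_repr_sub, real_inner_comm]
  -- ### Step 2: Fubini over `𝕋ᵈ × ℝᵈ`
  set wenv : EuclideanSpace ℝ d → ℝ := fun z =>
    (τ + ‖z‖ ^ 2) ^ (-(((Module.finrank ℝ (EuclideanSpace ℝ d) : ℝ) + 1) / 2)) with hwenv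
  have hgb : ∀ z y, ‖g z y‖ ≤ C * C₁ * C₂ * ‖w‖ * wenv z := by
    intro z y
    have hwz : 0 ≤ C * wenv z := mul_nonneg hC.le (Real.rpow_nonneg (by positivity) _)
    have hKz : ‖oseenKernel τ z (b₁ y) (b₂ y)‖ ≤ C * wenv z * C₁ * C₂ :=
      (hK hτ z _ _).trans (mul_le_mul (mul_le_mul_of_nonneg_left (hC₁ _) hwz) (hC₂ _)
        (norm_nonneg _) (mul_nonneg hwz hC₁0))
    have hn : ‖g z y‖ = |⟪oseenKernel τ z (b₁ y) (b₂ y), w⟫| := by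
      simp only [hg, Complex.norm_real, Real.norm_eq_abs]
    rw [hn]
    calc |⟪oseenKernel τ z (b₁ y) (b₂ y), w⟫| ≤ ‖oseenKernel τ z (b₁ y) (b₂ y)‖ * ‖w‖ :=
          abs_real_inner_le_norm _ _
      _ ≤ (C * wenv z * C₁ * C₂) * ‖w‖ := mul_le_mul_of_nonneg_right hKz (norm_nonneg _)
      _ = C * C₁ * C₂ * ‖w‖ * wenv z := by ring
  have hsh : Measurable fun p : UnitAddTorus d × EuclideanSpace ℝ d => p.1 - Torus.proj p.2 :=
    measurable_fst.sub (Torus.measurable_proj.comp measurable_snd)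
  have hgm : Measurable fun p : UnitAddTorus d × EuclideanSpace ℝ d => g p.2 (p.1 - Torus.proj p.2) := by
    simp only [hg]
    exact (Complex.measurable_ofReal.comp ((Measurable.oseenKernel_comp measurable_const
      measurable_snd (hb₁.measurable.comp hsh) (hb₂.measurable.comp hsh)).inner measurable_const))
  have hem : Measurable fun p : UnitAddTorus d × EuclideanSpace ℝ d => mFourier (-k) p.1 :=
    (mFourier (-k)).continuous.measurable.comp measurable_fst
  have hint : Integrable (uncurry fun (x : UnitAddTorus d) (z : EuclideanSpace ℝ d) =>
      mFourier (-k) x * g z (x - Torus.proj z)) (volume.prod volume) := by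
    refine Integrable.mono' (g := fun p => (1 : ℝ) * (C * C₁ * C₂ * ‖w‖ * wenv p.2))
      ((integrable_const (1 : ℝ)).mul_prod
        ((integrable_add_norm_sq_rpow_neg_half_succ hτ).const_mul (C * C₁ * C₂ * ‖w‖))) ?_ ?_
    · exact (hem.mul hgm).aestronglyMeasurable
    · refine Eventually.of_forall fun p => ?_
      calc ‖uncurry (fun (x : UnitAddTorus d) (z : EuclideanSpace ℝ d) =>
            mFourier (-k) x * g z (x - Torus.proj z)) p‖
          = ‖mFourier (-k) p.1‖ * ‖g p.2 (p.1 - Torus.proj p.2)‖ := norm_mul _ _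
        _ ≤ 1 * (C * C₁ * C₂ * ‖w‖ * wenv p.2) :=
          mul_le_mul (norm_mFourier_apply_le_one _ _) (hgb _ _) (norm_nonneg _) zero_le_one
  -- ### Step 3: the inner integral over the torus
  have hgc : ∀ z, Continuous (g z) := fun z => by
    have hK2 : Continuous fun y : UnitAddTorus d => oseenKernel τ z (b₁ y) (b₂ y) := by
      have h := ((oseenKernelCLM τ z).continuous₂).comp (hb₁.prodMk hb₂)
      simpa only [Function.comp_def, uncurry, oseenKernelCLM_apply] using h
    simp only [hg]
    exact Complex.continuous_ofReal.comp (hK2.inner continuous_const)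
  have h3 : ∀ z : EuclideanSpace ℝ d, ∫ x, mFourier (-k) x * g z (x - Torus.proj z) =
      mFourier (-k) (Torus.proj z) * ∫ x, mFourier (-k) x * g z x := by
    intro z
    have h := integral_sub_right_eq_self
      (fun x : UnitAddTorus d => mFourier (-k) (x + Torus.proj z) * g z x) (μ := volume) (Torus.proj z)
    simp only [sub_add_cancel] at h
    rw [h, ← integral_const_mul]
    refine integral_congr_ae (Eventually.of_forall fun x => ?_)
    dsimp only
    rw [mFourier_add_proj]
    ring
  -- ### Step 4: coordinate expansion of the inner integral
  have h4 : ∀ z : EuclideanSpace ℝ d, ∫ x, mFourier (-k) x * g z x =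
      ∑ j, ∑ l, Kjl j l z * mFourierCoeff (fun x : UnitAddTorus d => ((b₁ x j * b₂ x l : ℝ) : ℂ)) k := by
    intro z
    have hexp : ∀ x, mFourier (-k) x * g z x =
        ∑ j, ∑ l, Kjl j l z * (mFourier (-k) x * ((b₁ x j * b₂ x l : ℝ) : ℂ)) := by
      intro x
      simp only [hg, hKjl, inner_oseenKernel_eq_sum_coord τ z (b₁ x) (b₂ x) w]
      push_cast
      rw [Finset.mul_sum]
      refine Finset.sum_congr rfl fun j _ => ?_
      rw [Finset.mul_sum]
      refine Finset.sum_congr rfl fun l _ => ?_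
      ring
    simp_rw [hexp]
    have hi : ∀ j l, Integrable (fun x : UnitAddTorus d =>
        Kjl j l z * (mFourier (-k) x * ((b₁ x j * b₂ x l : ℝ) : ℂ))) volume := by
      intro j l
      refine Continuous.integrable_unitAddTorus
        (continuous_const.mul ((mFourier (-k)).continuous.mul ?_))
      exact Complex.continuous_ofReal.comp (((continuous_apply j).comp
        (PiLp.continuous_ofLp 2 _ |>.comp hb₁)).mul ((continuous_apply l).comp
        (PiLp.continuous_ofLp 2 _ |>.comp hb₂)))
    rw [integral_finsetSum _ fun j _ => integrable_finsetSum _ fun l _ => hi j l]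
    refine Finset.sum_congr rfl fun j _ => ?_
    rw [integral_finsetSum _ fun l _ => hi j l]
    refine Finset.sum_congr rfl fun l _ => ?_
    rw [integral_const_mul, mFourierCoeff_eq_integral_volume]
    simp only [smul_eq_mul]
  -- ### Step 5: the outer integral is the Fourier transform at the lattice point
  have hKi : ∀ j l, Integrable (Kjl j l) volume := fun j l => integrable_inner_oseenKernel hτ _ _ _
  have h5 : ∀ j l, ∫ z, mFourier (-k) (Torus.proj z) * Kjl j l z = 𝓕 (Kjl j l) (latticeVec k) := by
    intro j l
    rw [Real.fourier_eq]
    refine integral_congr_ae (Eventually.of_forall fun z => ?_)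
    dsimp only
    rw [mFourier_neg_proj, Circle.smul_def, smul_eq_mul]
  -- ### assembling
  calc mFourierCoeff (fun x : UnitAddTorus d =>
        ((⟪oseenSlice τ (Torus.lift b₁) (Torus.lift b₂) (Torus.repr x), w⟫ : ℝ) : ℂ)) k
      = ∫ x, mFourier (-k) x * ∫ z, g z (x - Torus.proj z) := by
        rw [mFourierCoeff_eq_integral_volume]
        refine integral_congr_ae (Eventually.of_forall fun x => ?_)
        dsimp only
        rw [smul_eq_mul, h1 x]
    _ = ∫ x, ∫ z, mFourier (-k) x * g z (x - Torus.proj z) := by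
        refine integral_congr_ae (Eventually.of_forall fun x => ?_)
        dsimp only
        exact (integral_const_mul _ _).symm
    _ = ∫ z, ∫ x, mFourier (-k) x * g z (x - Torus.proj z) := integral_integral_swap hint
    _ = ∫ z, mFourier (-k) (Torus.proj z) *
          ∑ j, ∑ l, Kjl j l z * mFourierCoeff (fun x : UnitAddTorus d => ((b₁ x j * b₂ x l : ℝ) : ℂ)) k := by
        refine integral_congr_ae (Eventually.of_forall fun z => ?_)
        dsimp only
        rw [h3 z, h4 z]
    _ = ∑ j, ∑ l, (∫ z, mFourier (-k) (Torus.proj z) * Kjl j l z) *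
          mFourierCoeff (fun x : UnitAddTorus d => ((b₁ x j * b₂ x l : ℝ) : ℂ)) k := by
        have hi : ∀ j l, Integrable (fun z : EuclideanSpace ℝ d => mFourier (-k) (Torus.proj z) *
            (Kjl j l z * mFourierCoeff (fun x : UnitAddTorus d => ((b₁ x j * b₂ x l : ℝ) : ℂ)) k))
            volume := by
          intro j l
          refine Integrable.bdd_mul (c := 1) ((hKi j l).mul_const _)
            ((mFourier (-k)).continuous.measurable.comp Torus.measurable_proj).aestronglyMeasurable
            (Eventually.of_forall fun z => norm_mFourier_apply_le_one _ _)
        have hexp : ∀ z : EuclideanSpace ℝ d, mFourier (-k) (Torus.proj z) *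
            ∑ j, ∑ l, Kjl j l z * mFourierCoeff (fun x : UnitAddTorus d => ((b₁ x j * b₂ x l : ℝ) : ℂ)) k =
            ∑ j, ∑ l, mFourier (-k) (Torus.proj z) *
              (Kjl j l z * mFourierCoeff (fun x : UnitAddTorus d => ((b₁ x j * b₂ x l : ℝ) : ℂ)) k) := by
          intro z
          rw [Finset.mul_sum]
          refine Finset.sum_congr rfl fun j _ => ?_
          rw [Finset.mul_sum]
        simp_rw [hexp]
        rw [integral_finsetSum _ fun j _ => integrable_finsetSum _ fun l _ => hi j l]
        refine Finset.sum_congr rfl fun j _ => ?_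
        rw [integral_finsetSum _ fun l _ => hi j l]
        refine Finset.sum_congr rfl fun l _ => ?_
        rw [← integral_mul_const]
        refine integral_congr_ae (Eventually.of_forall fun z => ?_)
        dsimp only
        ring
    _ = _ := by
        refine Finset.sum_congr rfl fun j _ => Finset.sum_congr rfl fun l _ => ?_
        rw [h5 j l]

/-! ### The symbol bound -/

omit [Fintype d] [DecidableEq d] in
/-- **The symbol of the Oseen kernel is bounded by `2π|ξ|`**:
`‖𝓕(z ↦ ⟪K(τ,z)[a,b], w⟫)(ξ)‖ ≤ 2π ‖ξ‖ ‖a‖ ‖b‖ ‖w‖` (`|Ĝ_τ| ≤ 1`, `‖P(ξ)‖ ≤ 1`).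
[cite: KochTataruAdvMath2001, §2 (6), (8)] -/
theorem norm_fourier_inner_oseenKernel_le {E : Type*} [NormedAddCommGroup E] [InnerProductSpace ℝ E]
    [FiniteDimensional ℝ E] [MeasurableSpace E] [BorelSpace E] {τ : ℝ} (hτ : 0 < τ) (a b w ξ : E) :
    ‖𝓕 (fun z : E => ((⟪oseenKernel τ z a b, w⟫ : ℝ) : ℂ)) ξ‖ ≤ 2 * Real.pi * ‖ξ‖ * ‖a‖ * ‖b‖ * ‖w‖ := by
  rw [fourier_inner_oseenKernel_eq_leraySymbol hτ]
  have h1 : |⟪ξ, a⟫| ≤ ‖ξ‖ * ‖a‖ := abs_real_inner_le_norm _ _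
  have h2 : |UnboundedOperators.heatSymbol τ ξ| ≤ 1 := by
    rw [abs_of_pos (UnboundedOperators.heatSymbol_pos τ ξ)]
    exact UnboundedOperators.heatSymbol_le_one hτ.le ξ
  have h3 : |⟪leraySymbol ξ b, w⟫| ≤ ‖b‖ * ‖w‖ :=
    (abs_real_inner_le_norm _ _).trans (mul_le_mul_of_nonneg_right (norm_leraySymbol_apply_le ξ b)
      (norm_nonneg _))
  simp only [norm_mul, Complex.norm_real, Complex.norm_I, Real.norm_eq_abs, Complex.norm_ofNat,
    abs_of_pos Real.pi_pos, mul_one]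
  calc 2 * Real.pi * |⟪ξ, a⟫| * |UnboundedOperators.heatSymbol τ ξ| * |⟪leraySymbol ξ b, w⟫|
      ≤ 2 * Real.pi * (‖ξ‖ * ‖a‖) * 1 * (‖b‖ * ‖w‖) := by
        gcongr
    _ = 2 * Real.pi * ‖ξ‖ * ‖a‖ * ‖b‖ * ‖w‖ := by ring

/-- **`Ḣ^{-1}`-type bound for the Oseen slice of periodic data**: for continuous `b₁, b₂`, `τ > 0`,
`‖(⟪N_τ[b̃₁,b̃₂], w⟫)^(k)‖ ≤ 2π |k| ‖w‖ ∑ⱼₗ ‖(b₁ⱼ b₂ₗ)^(k)‖` — one power of `|k|` from the divergence,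
nothing from the heat factor: the mechanism of "`w(t) → 0` in `𝒞^{-1+α/2}`" (Prop. 4.3) in `Ḣ^{-1}`
form. [cite: CoiculescuPalasek2025, proof of Prop. 4.3 (last display: control of w near t = 0)] -/
theorem norm_mFourierCoeff_inner_oseenSlice_lift_le {b₁ b₂ : UnitAddTorus d → EuclideanSpace ℝ d}
    (hb₁ : Continuous b₁) (hb₂ : Continuous b₂) {τ : ℝ} (hτ : 0 < τ) (w : EuclideanSpace ℝ d)
    (k : d → ℤ) :
    ‖mFourierCoeff (fun x : UnitAddTorus d =>
      ((⟪oseenSlice τ (Torus.lift b₁) (Torus.lift b₂) (Torus.repr x), w⟫ : ℝ) : ℂ)) k‖ ≤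
      2 * Real.pi * ‖latticeVec k‖ * ‖w‖ *
        ∑ j, ∑ l, ‖mFourierCoeff (fun x : UnitAddTorus d => ((b₁ x j * b₂ x l : ℝ) : ℂ)) k‖ := by
  rw [mFourierCoeff_inner_oseenSlice_lift hb₁ hb₂ hτ w k, Finset.mul_sum]
  refine (norm_sum_le _ _).trans (Finset.sum_le_sum fun j _ => ?_)
  rw [Finset.mul_sum]
  refine (norm_sum_le _ _).trans (Finset.sum_le_sum fun l _ => ?_)
  rw [norm_mul]
  refine mul_le_mul_of_nonneg_right ?_ (norm_nonneg _)
  have h := norm_fourier_inner_oseenKernel_le hτ (EuclideanSpace.single j (1:ℝ))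
    (EuclideanSpace.single l (1:ℝ)) w (latticeVec k)
  simpa [PiLp.norm_single] using h

/-! ### Periodisation of the heat flow -/

/-- `e_{-k}(proj z) = e_k(-proj z)`. [folklore] -/
theorem mFourier_neg_proj_eq (k : d → ℤ) (z : EuclideanSpace ℝ d) :
    mFourier (-k) (Torus.proj z) = mFourier k (-Torus.proj z) := by
  rw [mFourier_neg_proj, ← Torus.proj_neg, mFourier_proj_eq_fourierChar, inner_neg_left]

/-- **Fourier coefficients of the heat flow of periodic data (periodisation of the Gaussian).**
For continuous `a : 𝕋ᵈ → ℝᵈ`, `t > 0`, `w ∈ ℝᵈ`, `k ∈ ℤᵈ`: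
`(⟪e^{tΔ}ã ∘ repr, w⟫)^(k) = e^{-4π²t|k|²} (⟪a, w⟫)^(k)` — on periodic data `e^{tΔ}` is the Fourier
multiplier `e^{-4π²t|k|²}` (the paper's `P_{≤N}`/heat calculus of §2.2 on `𝕋³`).
[cite: CoiculescuPalasek2025, §2.2 (the heat propagator as a Fourier multiplier on 𝕋³)] -/
theorem mFourierCoeff_inner_heatExtension_lift {a : UnitAddTorus d → EuclideanSpace ℝ d}
    (ha : Continuous a) {t : ℝ} (ht : 0 < t) (w : EuclideanSpace ℝ d) (k : d → ℤ) :
    mFourierCoeff (fun x : UnitAddTorus d =>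
      ((⟪UnboundedOperators.heatExtension (Torus.lift a) t (Torus.repr x), w⟫ : ℝ) : ℂ)) k =
      (Real.exp (-(t * (4 * Real.pi ^ 2 * freqNormSq k))) : ℂ) *
        mFourierCoeff (fun x : UnitAddTorus d => ((⟪a x, w⟫ : ℝ) : ℂ)) k := by
  obtain ⟨Ca, hCa0, hCa⟩ := TorusHeat.exists_norm_le ha
  set g : UnitAddTorus d → ℂ := fun y => ((⟪a y, w⟫ : ℝ) : ℂ) with hg
  have hgc : Continuous g := Complex.continuous_ofReal.comp (ha.inner continuous_const)
  have hgb : ∀ y, ‖g y‖ ≤ Ca * ‖w‖ := fun y => by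
    simp only [hg, Complex.norm_real, Real.norm_eq_abs]
    exact (abs_real_inner_le_norm _ _).trans (mul_le_mul_of_nonneg_right (hCa y) (norm_nonneg _))
  -- ### Step 1
  have h1 : ∀ x : UnitAddTorus d,
      ((⟪UnboundedOperators.heatExtension (Torus.lift a) t (Torus.repr x), w⟫ : ℝ) : ℂ) =
        ∫ z, (UnboundedOperators.heatKernel t z : ℂ) * g (x - Torus.proj z) := by
    intro x
    have hint : Integrable (fun z => UnboundedOperators.heatKernel t z • a (x - Torus.proj z)) volume := by
      refine Integrable.mono' ((UnboundedOperators.integrable_heatKernel_holds ht).mul_const Ca) ?_ ?_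
      · exact (((UnboundedOperators.continuous_heatKernel t)).smul
          (ha.comp (continuous_const.sub Torus.continuous_proj))).aestronglyMeasurable
      · refine Eventually.of_forall fun z => ?_
        rw [norm_smul, Real.norm_of_nonneg (UnboundedOperators.heatKernel_pos ht z).le]
        exact mul_le_mul_of_nonneg_left (hCa _) (UnboundedOperators.heatKernel_pos ht z).le
    rw [UnboundedOperators.heatExtension_apply]
    simp_rw [lift_repr_sub]
    rw [real_inner_comm, ← integral_inner hint, ← integral_complex_ofReal]
    refine integral_congr_ae (Eventually.of_forall fun z => ?_)
    dsimp only
    rw [hg, inner_smul_right, real_inner_comm]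
    push_cast
    ring
  -- ### Step 2: Fubini
  have hint : Integrable (uncurry fun (x : UnitAddTorus d) (z : EuclideanSpace ℝ d) =>
      mFourier (-k) x * ((UnboundedOperators.heatKernel t z : ℂ) * g (x - Torus.proj z)))
      (volume.prod volume) := by
    refine Integrable.mono' (g := fun p => (1 : ℝ) * (UnboundedOperators.heatKernel t p.2 * (Ca * ‖w‖)))
      ((integrable_const (1 : ℝ)).mul_prod
        ((UnboundedOperators.integrable_heatKernel_holds ht).mul_const (Ca * ‖w‖))) ?_ ?_
    · exact (((mFourier (-k)).continuous.comp continuous_fst).mul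
        ((Complex.continuous_ofReal.comp ((UnboundedOperators.continuous_heatKernel t).comp
          continuous_snd)).mul (hgc.comp (continuous_fst.sub
          (Torus.continuous_proj.comp continuous_snd))))).aestronglyMeasurable
    · refine Eventually.of_forall fun p => ?_
      simp only [uncurry, norm_mul, Complex.norm_real,
        Real.norm_of_nonneg (UnboundedOperators.heatKernel_pos ht p.2).le]
      exact mul_le_mul (norm_mFourier_apply_le_one _ _)
        (mul_le_mul_of_nonneg_left (hgb _) (UnboundedOperators.heatKernel_pos ht p.2).le)
        (mul_nonneg (UnboundedOperators.heatKernel_pos ht p.2).le (norm_nonneg _)) zero_le_one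
  -- ### Step 3: inner integral
  have h3 : ∀ z : EuclideanSpace ℝ d, ∫ x, mFourier (-k) x * ((UnboundedOperators.heatKernel t z : ℂ) *
      g (x - Torus.proj z)) = (UnboundedOperators.heatKernel t z : ℂ) * mFourier k (-Torus.proj z) *
        mFourierCoeff g k := by
    intro z
    have h := integral_sub_right_eq_self
      (fun x : UnitAddTorus d => mFourier (-k) (x + Torus.proj z) *
        ((UnboundedOperators.heatKernel t z : ℂ) * g x)) (μ := volume) (Torus.proj z)
    simp only [sub_add_cancel] at h
    rw [h, mFourierCoeff_eq_integral_volume, ← integral_const_mul]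
    refine integral_congr_ae (Eventually.of_forall fun x => ?_)
    dsimp only
    rw [mFourier_add_proj, mFourier_neg_proj_eq, smul_eq_mul]
    ring
  -- ### assembling
  calc mFourierCoeff (fun x : UnitAddTorus d =>
        ((⟪UnboundedOperators.heatExtension (Torus.lift a) t (Torus.repr x), w⟫ : ℝ) : ℂ)) k
      = ∫ x, mFourier (-k) x * ∫ z, (UnboundedOperators.heatKernel t z : ℂ) * g (x - Torus.proj z) := by
        rw [mFourierCoeff_eq_integral_volume]
        refine integral_congr_ae (Eventually.of_forall fun x => ?_)
        dsimp only
        rw [smul_eq_mul, h1 x]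
    _ = ∫ x, ∫ z, mFourier (-k) x * ((UnboundedOperators.heatKernel t z : ℂ) * g (x - Torus.proj z)) := by
        refine integral_congr_ae (Eventually.of_forall fun x => ?_)
        dsimp only
        exact (integral_const_mul _ _).symm
    _ = ∫ z, ∫ x, mFourier (-k) x * ((UnboundedOperators.heatKernel t z : ℂ) * g (x - Torus.proj z)) :=
        integral_integral_swap hint
    _ = ∫ z, (UnboundedOperators.heatKernel t z : ℂ) * mFourier k (-Torus.proj z) * mFourierCoeff g k := by
        refine integral_congr_ae (Eventually.of_forall fun z => ?_)
        dsimp only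
        rw [h3 z]
    _ = (∫ z, (UnboundedOperators.heatKernel t z : ℂ) * mFourier k (-Torus.proj z)) * mFourierCoeff g k :=
        integral_mul_const _ _
    _ = _ := by rw [integral_heatKernel_mul_mFourier ht k]

end Torus

end Literature.Analysis.FluidPDE
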